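import Literature.Analysis.FluidPDE.Seregin2020ScaledEnergyBoundsA
import Literature.Analysis.FluidPDE.Seregin2020LocalEnergyProduct
import Literature.Analysis.FluidPDE.Seregin2020DecayInterpolation
import Literature.Analysis.FluidPDE.Seregin2020PressureMeanZero
import Literature.Analysis.FluidPDE.PoincareBall
import Literature.Analysis.FluidPDE.CKNLocalRegularityRRSPressure
import HarnessLib

/-!
# Seregin 2020, the step "`g(z₀) < ∞ ⇒ G(z₀) < ∞`" of the proof of Theorem 2.1: the case of a
# bounded dissipation `E`, and the assembly of the three cases

Analysis/FluidPDE proof file (everything proved; no definitions, no named facts), sixth file of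
the bottom-up discharge of
`Literature.Analysis.FluidPDE.Seregin2020_axisymmetricSingularPoint_typeII` (G. Seregin,
Anal. Math. Phys. 10 (2020) = arXiv:2006.04140, Thm. 2.1). It completes the first step of the
printed proof of Theorem 2.1 — the remark following Def. 1.7, "if `g(z₀) < ∞`, see [Seregin2006],
then `G(z₀) < ∞` … `D₀` can be replaced with `D`", used as (2.7),
`L₀ = sup_{0<r<1} A(r) + sup C(r) + sup E(r) + sup D(r) < ∞` — by treating the case
**`limsup_{r→0} E(z₀, r) < ∞`** (the Caffarelli–Kohn–Nirenberg quantity) and assembling it with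
the cases `C` (`Seregin2020ScaledEnergyBounds.lean`) and `A` (`Seregin2020ScaledEnergyBoundsA.lean`).

## The case `E` (Seregin 2006; Seregin 2014, proof of Thm. 1.4, (6.1.44)–(6.1.50) with `ε := M`)

With `E(r) ≤ M` on `]0, r₀]` the energy `A` may be large, and the iteration runs on
`𝓔(r) = A(r)^{3/2} + ω D(r)²`. For `0 < ϱ ≤ r₀` and a ratio `κ ≤ 1/2`:

* `A(κϱ/2)^{3/2} ≤ 4[k₁^{3/2} C(κϱ) + k₂^{3/2} (A(κϱ)E(κϱ))^{3/4} C(κϱ)^{1/2} + k₃^{3/2} D(κϱ) C(κϱ)^{1/2}]`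
  (product-form local energy estimate at the top, `localEnergyProduct_top`, (6.1.36));
* `C(κϱ) ≤ C₆ [κ³ A(ϱ)^{3/2} + κ⁻³ A(ϱ)^{3/4} M^{3/4}]` (decay interpolation `exists_cknC_le_decay`,
  Lemma 6.2) — the superlinear term `A^{3/2}` comes with the small factor `κ³`;
* `A(κϱ) ≤ κ⁻¹ A(ϱ)`, `E(κϱ) ≤ M`;
* `D(κϱ) ≤ κ₇ κ⁻² A(ϱ)^{1/2} M + κ₈ κ D(ϱ)` (`pressureEstimateMeanZero_top`, Lemma 6.4) — the
  velocity enters `D²` only through `A = (A^{3/2})^{2/3}`, sublinearly; `D(κϱ/2) ≤ 4 D(κϱ)`.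

After Young's inequality on `D C^{1/2}` (weight `ω ≍ κ²`) every term is either LINEAR in `A^{3/2}`
with a coefficient `c κ^e`, `e > 0` (`4k₁^{3/2}C₆κ³`, `4k₃^{3/2}C₆κ`, `4k₂^{3/2}C₆^{1/2}M^{3/4}κ^{3/4}`),
or linear in `ω D²` with coefficient `34κ₈²κ²`, or SUBLINEAR (powers `1/2, 3/4, 2/3` of `A^{3/2}`);
choosing `κ = κ(M)` small (`exists_small_mul_rpow_le`) and absorbing the sublinear terms
(`rpow_le_mul_add`) gives `𝓔(κϱ/2) ≤ 𝓔(ϱ)/2 + b`. The geometric iteration (`iterate_half_le`)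
and monotonicity bound `A` on `]0, r₀]`, and the case `A` (`scaledEnergies_bounded_of_cknAEss_le`)
concludes.

## Contents (namespace `Literature.Analysis.FluidPDE.Seregin2020`)

* tools: `exists_small_mul_rpow_le`, `mul_rpow_half_le_weighted`, exponent bookkeeping (and the
  tree's `RRS2016.ennreal_add_three_rpow_threeHalves_le`, `PoincareBall.add_sq_le_two_mul_sq_add`);
* `scaledEnergies_bounded_of_cknE_le` — **the case `E`**;
  `scaledEnergies_bounded_of_limsup_cknE_lt_top`;
* `scaledEnergies_bounded_of_blowupIndex_lt_top` — **`g(z) < ∞ ⇒` `A, E, C, D` bounded near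
  `z`** (the three cases);
* `typeI_scaledEnergies_bounded` — the same under the hypotheses of Theorem 2.1 (Seregin's unit
  cylinder `Q = 𝒞 × ]-1, 0[`, Def. 1.3's global classes, `g(0) < ∞`): the bound (2.7).

## References

* G. Seregin, Anal. Math. Phys. 10 (2020), Paper 46 = arXiv:2006.04140: Def. 1.7 and the remark
  following it; proof of Thm. 2.1, (2.5)–(2.7). [`Seregin2020`]
* G. Seregin, *Lecture Notes on Regularity Theory for the Navier–Stokes Equations* (2014), proof of
  Thm. 1.4, (6.1.44)–(6.1.52); Lemmas 6.2–6.4. [`Seregin2014`]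
* G. Seregin, Zap. Nauchn. Sem. POMI 336 (2006) = J. Math. Sci. 143 (2007) (estimates in critical
  Morrey spaces). [`Seregin2006`]
-/

noncomputable section

open MeasureTheory Set Function Filter Topology TopologicalSpace Metric InnerProductSpace Module
open scoped ENNReal NNReal RealInnerProductSpace

namespace Literature.Analysis.FluidPDE

namespace Seregin2020

/-! ### E-case tools -/

/-- For a finite `c`, a non-zero `q` and `e > 0`, `c κ^e ≤ q` for all small `κ > 0`. [folklore] -/
theorem exists_small_mul_rpow_le {c : ℝ≥0∞} (hc : c ≠ ∞) {q : ℝ≥0∞} (hq : q ≠ 0) {e : ℝ} (he : 0 < e) :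
    ∃ κ₀ : ℝ, 0 < κ₀ ∧ ∀ κ ∈ Ioc (0 : ℝ) κ₀, c * ENNReal.ofReal κ ^ e ≤ q := by
  have h1 : Tendsto (fun κ : ℝ => κ ^ e) (𝓝 0) (𝓝 0) := by
    have := (Real.continuous_rpow_const he.le).tendsto 0
    rwa [Real.zero_rpow he.ne'] at this
  have h2 : Tendsto (fun κ : ℝ => ENNReal.ofReal (κ ^ e)) (𝓝 0) (𝓝 0) := by
    have := ENNReal.tendsto_ofReal h1
    rwa [ENNReal.ofReal_zero] at this
  have h3 : Tendsto (fun κ : ℝ => c * ENNReal.ofReal (κ ^ e)) (𝓝 0) (𝓝 0) := by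
    have := ENNReal.Tendsto.const_mul h2 (Or.inr hc)
    rwa [mul_zero] at this
  have h4 : ∀ᶠ κ in 𝓝[>] (0 : ℝ), c * ENNReal.ofReal (κ ^ e) < q :=
    ((tendsto_order.1 h3).2 q (pos_iff_ne_zero.2 hq)).filter_mono nhdsWithin_le_nhds
  rw [(nhdsGT_basis (0 : ℝ)).eventually_iff] at h4
  obtain ⟨ε, hε, h⟩ := h4
  refine ⟨ε / 2, half_pos hε, fun κ hκ => ?_⟩
  rw [ENNReal.ofReal_rpow_of_nonneg hκ.1.le he.le]
  refine (h ?_).le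
  rw [mem_Ioo]
  exact ⟨hκ.1, by linarith [hκ.2]⟩

/-- Weighted Young: `D C^{1/2} ≤ t² D² + t⁻¹² C` for `0 < t < ∞`. [folklore] -/
theorem mul_rpow_half_le_weighted (D C : ℝ≥0∞) {t : ℝ≥0∞} (ht0 : t ≠ 0) (httop : t ≠ ∞) :
    D * C ^ (1 / 2 : ℝ) ≤ t ^ 2 * D ^ 2 + t⁻¹ ^ 2 * C := by
  have hsq : ∀ x y : ℝ≥0∞, x * y ≤ x ^ 2 + y ^ 2 := fun x y => by
    rcases le_total x y with h | h
    · calc x * y ≤ y * y := mul_le_mul_left h _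
        _ = y ^ 2 := (sq y).symm
        _ ≤ x ^ 2 + y ^ 2 := le_add_self
    · calc x * y ≤ x * x := mul_le_mul_right h _
        _ = x ^ 2 := (sq x).symm
        _ ≤ x ^ 2 + y ^ 2 := le_self_add
  have key := hsq (t * D) (t⁻¹ * C ^ (1 / 2 : ℝ))
  have e1 : t * D * (t⁻¹ * C ^ (1 / 2 : ℝ)) = D * C ^ (1 / 2 : ℝ) := by
    calc t * D * (t⁻¹ * C ^ (1 / 2 : ℝ)) = (t * t⁻¹) * (D * C ^ (1 / 2 : ℝ)) := by ring
      _ = D * C ^ (1 / 2 : ℝ) := by rw [ENNReal.mul_inv_cancel ht0 httop, one_mul]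
  have e2 : (t⁻¹ * C ^ (1 / 2 : ℝ)) ^ 2 = t⁻¹ ^ 2 * C := by
    rw [mul_pow, ← ENNReal.rpow_natCast (C ^ (1 / 2 : ℝ)) 2, ← ENNReal.rpow_mul]
    norm_num
  rw [e1, mul_pow, e2] at key
  exact key

/-- Exponent bookkeeping: `X⁻¹² X³ = X` for `0 < X < ∞`. [folklore] -/
theorem inv_sq_mul_cube {X : ℝ≥0∞} (h0 : X ≠ 0) (htop : X ≠ ∞) : X⁻¹ ^ 2 * X ^ 3 = X := by
  calc X⁻¹ ^ 2 * X ^ 3 = (X⁻¹ * X) * (X⁻¹ * X) * X := by ring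
    _ = X := by rw [ENNReal.inv_mul_cancel h0 htop, one_mul, one_mul]

/-- Exponent bookkeeping: `X⁻¹^{3/4} X^{3/2} = X^{3/4}` for `0 < X < ∞`. [folklore] -/
theorem inv_rpow_mul_rpow_threeHalves {X : ℝ≥0∞} (h0 : X ≠ 0) (htop : X ≠ ∞) :
    X⁻¹ ^ (3 / 4 : ℝ) * X ^ (3 / 2 : ℝ) = X ^ (3 / 4 : ℝ) := by
  rw [ENNReal.inv_rpow, ← ENNReal.rpow_neg, ← ENNReal.rpow_add _ _ h0 htop]
  norm_num

/-- **Seregin 2020, remark after Def. 1.7 (after Seregin 2006), the case of a bounded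
dissipation `E`** — the case of the Caffarelli–Kohn–Nirenberg quantity. Let `(u, p)` be a
suitable weak solution of the unforced Navier–Stokes equations (`ν = 1`) on an open `Q`, `G` a
weak spatial gradient of `u` on `Q`, `Q_{r₀}(z) ⊆ Q` (possibly touching the top of `Q`) with
`A(r₀; z), D(r₀; z) < ∞`. If `E(r; z) ≤ M` for all `0 < r ≤ r₀`, then `A + E + C + D ≤ K` on
`]0, r₀/2]` for some `K < ∞`. Proof: Seregin's iteration for `𝓔(r) = A(r)^{3/2} + ω D(r)²`
(Seregin 2014, proof of Thm. 1.4, (6.1.44)–(6.1.50), run with `ε` replaced by the bound `M`):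
by the product-form local energy estimate (`localEnergyProduct_top`), the decay interpolation
`exists_cknC_le_decay` (Lemma 6.2) and the pressure estimate `pressureEstimateMeanZero_top`
(Lemma 6.4), `𝓔(κϱ/2) ≤ 𝓔(ϱ)/2 + b` for a ratio `κ = κ(M)` and all `0 < ϱ ≤ r₀`; the geometric
iteration bounds `A` on `]0, r₀]`, and `scaledEnergies_bounded_of_cknAEss_le` concludes.
[cite: Seregin2020, remark after Def. 1.7 and (2.7); Seregin2014 proof of Thm. 1.4 (6.1.44)–(6.1.50)] -/
theorem scaledEnergies_bounded_of_cknE_le {Q : Opens (ℝ × EuclideanSpace ℝ (Fin 3))}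
    {u : ℝ → EuclideanSpace ℝ (Fin 3) → EuclideanSpace ℝ (Fin 3)}
    {p : ℝ → EuclideanSpace ℝ (Fin 3) → ℝ}
    {G : ℝ → EuclideanSpace ℝ (Fin 3) → EuclideanSpace ℝ (Fin 3) →L[ℝ] EuclideanSpace ℝ (Fin 3)}
    (hsw : IsSuitableWeakSolutionOn Q 1 0 u p) (hG : HasWeakSpatialGradientOn Q u G)
    {z : ℝ × EuclideanSpace ℝ (Fin 3)} {r₀ : ℝ} (hr₀ : 0 < r₀)
    (hQ : parabolicCylinder r₀ z ⊆ (Q : Set (ℝ × EuclideanSpace ℝ (Fin 3))))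
    (hA₀ : cknAEss r₀ z u ≠ ∞) (hD₀ : cknD r₀ z p ≠ ∞) {M : ℝ≥0}
    (hM : ∀ r ∈ Ioc (0 : ℝ) r₀, cknE r z G ≤ M) :
    ∃ K : ℝ≥0, ∀ r ∈ Ioc (0 : ℝ) (r₀ / 2),
      cknAEss r z u + cknE r z G + cknC r z u + cknD r z p ≤ K := by
  -- ### the constants of the three estimates
  obtain ⟨k₁, k₂, k₃, HT⟩ := localEnergyProduct_top
  obtain ⟨C₆, hC₆⟩ := exists_cknC_le_decay
  obtain ⟨κ₇, κ₈, HP⟩ := pressureEstimateMeanZero_top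
  -- ### the unit `q = 1/16` and the choice of the ratio `κ`
  set q : ℝ≥0∞ := ENNReal.ofReal (1 / 16) with hq
  have hq0 : q ≠ 0 := (ENNReal.ofReal_pos.2 (by norm_num)).ne'
  have hqtop : q ≠ ∞ := ENNReal.ofReal_ne_top
  have h8q : 8 * q = 2⁻¹ := by
    rw [hq, ← ENNReal.ofReal_ofNat 8, ← ENNReal.ofReal_mul (by norm_num),
      show (8 : ℝ) * (1 / 16) = 2⁻¹ by norm_num, ENNReal.ofReal_inv_of_pos two_pos, ENNReal.ofReal_ofNat]
  have h2i0 : (2⁻¹ : ℝ≥0∞) ≠ 0 := ENNReal.inv_ne_zero.2 ENNReal.ofNat_ne_top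
  obtain ⟨κa, hκa, Ha⟩ := exists_small_mul_rpow_le (c := 34 * (κ₈ : ℝ≥0∞) ^ 2)
    (ENNReal.mul_ne_top ENNReal.ofNat_ne_top (ENNReal.pow_ne_top ENNReal.coe_ne_top)) h2i0 two_pos
  obtain ⟨κb, hκb, Hb⟩ := exists_small_mul_rpow_le (c := 4 * (k₁ : ℝ≥0∞) ^ (3 / 2 : ℝ) * C₆)
    (ENNReal.mul_ne_top (ENNReal.mul_ne_top ENNReal.ofNat_ne_top
      (ENNReal.rpow_ne_top_of_nonneg (by norm_num) ENNReal.coe_ne_top)) ENNReal.coe_ne_top) hq0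
    (by norm_num : (0 : ℝ) < 3)
  obtain ⟨κc, hκc, Hc⟩ := exists_small_mul_rpow_le (c := 4 * (k₃ : ℝ≥0∞) ^ (3 / 2 : ℝ) * C₆)
    (ENNReal.mul_ne_top (ENNReal.mul_ne_top ENNReal.ofNat_ne_top
      (ENNReal.rpow_ne_top_of_nonneg (by norm_num) ENNReal.coe_ne_top)) ENNReal.coe_ne_top) hq0 one_pos
  obtain ⟨κd, hκd, Hd⟩ := exists_small_mul_rpow_le
    (c := 4 * (k₂ : ℝ≥0∞) ^ (3 / 2 : ℝ) * (C₆ : ℝ≥0∞) ^ (1 / 2 : ℝ) * (M : ℝ≥0∞) ^ (3 / 4 : ℝ))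
    (ENNReal.mul_ne_top (ENNReal.mul_ne_top (ENNReal.mul_ne_top ENNReal.ofNat_ne_top
      (ENNReal.rpow_ne_top_of_nonneg (by norm_num) ENNReal.coe_ne_top))
      (ENNReal.rpow_ne_top_of_nonneg (by norm_num) ENNReal.coe_ne_top))
      (ENNReal.rpow_ne_top_of_nonneg (by norm_num) ENNReal.coe_ne_top))
    (q := 2 * q) (mul_ne_zero two_ne_zero hq0) (by norm_num : (0 : ℝ) < 3 / 4)
  set κ : ℝ := min (1 / 2) (min κa (min κb (min κc κd))) with hκdef
  have hκ0 : 0 < κ := lt_min (by norm_num) (lt_min hκa (lt_min hκb (lt_min hκc hκd)))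
  have hκhalf : κ ≤ 1 / 2 := min_le_left _ _
  have hκ1 : κ ≤ 1 := hκhalf.trans (by norm_num)
  have hκa' : κ ∈ Ioc (0 : ℝ) κa := ⟨hκ0, (min_le_right _ _).trans (min_le_left _ _)⟩
  have hκb' : κ ∈ Ioc (0 : ℝ) κb :=
    ⟨hκ0, (min_le_right _ _).trans ((min_le_right _ _).trans (min_le_left _ _))⟩
  have hκc' : κ ∈ Ioc (0 : ℝ) κc :=
    ⟨hκ0, (min_le_right _ _).trans ((min_le_right _ _).trans ((min_le_right _ _).trans (min_le_left _ _)))⟩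
  have hκd' : κ ∈ Ioc (0 : ℝ) κd :=
    ⟨hκ0, (min_le_right _ _).trans ((min_le_right _ _).trans ((min_le_right _ _).trans (min_le_right _ _)))⟩
  set X : ℝ≥0∞ := ENNReal.ofReal κ with hX
  have hX0 : X ≠ 0 := (ENNReal.ofReal_pos.2 hκ0).ne'
  have hXtop : X ≠ ∞ := ENNReal.ofReal_ne_top
  set Xi : ℝ≥0∞ := X⁻¹ with hXi
  have hXitop : Xi ≠ ∞ := ENNReal.inv_ne_top.2 hX0
  have hXieq : ENNReal.ofReal κ⁻¹ = Xi := by rw [hXi, hX, ENNReal.ofReal_inv_of_pos hκ0]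
  set Y : ℝ≥0∞ := ENNReal.ofReal ((κ ^ 2)⁻¹) with hY
  have hYtop : Y ≠ ∞ := ENNReal.ofReal_ne_top
  -- the four smallness conditions, in the forms used below
  have hXnat : ∀ n : ℕ, X ^ (n : ℝ) = X ^ n := fun n => ENNReal.rpow_natCast X n
  have Ha' : 34 * (κ₈ : ℝ≥0∞) ^ 2 * X ^ 2 ≤ 2⁻¹ := by
    have := Ha κ hκa'; rwa [show (2 : ℝ) = ((2 : ℕ) : ℝ) by norm_num, hXnat] at this
  have Hb' : 4 * (k₁ : ℝ≥0∞) ^ (3 / 2 : ℝ) * C₆ * X ^ 3 ≤ q := by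
    have := Hb κ hκb'; rwa [show (3 : ℝ) = ((3 : ℕ) : ℝ) by norm_num, hXnat] at this
  have Hc' : 4 * (k₃ : ℝ≥0∞) ^ (3 / 2 : ℝ) * C₆ * X ≤ q := by
    have := Hc κ hκc'; rwa [ENNReal.rpow_one] at this
  have Hd' : 4 * (k₂ : ℝ≥0∞) ^ (3 / 2 : ℝ) * (C₆ : ℝ≥0∞) ^ (1 / 2 : ℝ) * (M : ℝ≥0∞) ^ (3 / 4 : ℝ) *
      X ^ (3 / 4 : ℝ) ≤ 2 * q := Hd κ hκd'
  -- ### the weight `ω`, the sublinear coefficients and the absorption constants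
  set ω : ℝ≥0∞ := (4 * (k₃ : ℝ≥0∞) ^ (3 / 2 : ℝ) + 1) * X ^ 2 with hω
  have hωtop : ω ≠ ∞ := ENNReal.mul_ne_top (ENNReal.add_ne_top.2 ⟨ENNReal.mul_ne_top ENNReal.ofNat_ne_top
    (ENNReal.rpow_ne_top_of_nonneg (by norm_num) ENNReal.coe_ne_top), ENNReal.one_ne_top⟩)
    (ENNReal.pow_ne_top hXtop)
  have hk3ω : 4 * (k₃ : ℝ≥0∞) ^ (3 / 2 : ℝ) * X ^ 2 ≤ ω := by
    rw [hω]; gcongr; exact le_self_add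
  set S₁ : ℝ≥0∞ := 4 * (k₁ : ℝ≥0∞) ^ (3 / 2 : ℝ) * (C₆ * Xi ^ 3 * (M : ℝ≥0∞) ^ (3 / 4 : ℝ)) with hS₁
  set S₂ : ℝ≥0∞ := 4 * (k₃ : ℝ≥0∞) ^ (3 / 2 : ℝ) * Xi ^ 2 * (C₆ * Xi ^ 3 * (M : ℝ≥0∞) ^ (3 / 4 : ℝ)) with hS₂
  set S₃ : ℝ≥0∞ := 4 * (k₂ : ℝ≥0∞) ^ (3 / 2 : ℝ) * (Xi ^ (3 / 4 : ℝ) * (M : ℝ≥0∞) ^ (3 / 4 : ℝ)) *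
    ((C₆ : ℝ≥0∞) ^ (1 / 2 : ℝ) * Xi ^ (3 / 2 : ℝ) * (M : ℝ≥0∞) ^ (3 / 8 : ℝ)) with hS₃
  set S₄ : ℝ≥0∞ := 17 * ω * (2 * (κ₇ : ℝ≥0∞) ^ 2 * Y ^ 2 * (M : ℝ≥0∞) ^ 2) with hS₄
  have hMt : ∀ e : ℝ, 0 ≤ e → (M : ℝ≥0∞) ^ e ≠ ∞ := fun e he => ENNReal.rpow_ne_top_of_nonneg he ENNReal.coe_ne_top
  have hXit : ∀ e : ℝ, 0 ≤ e → Xi ^ e ≠ ∞ := fun e he => ENNReal.rpow_ne_top_of_nonneg he hXitop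
  have hS₁top : S₁ ≠ ∞ := ENNReal.mul_ne_top (ENNReal.mul_ne_top ENNReal.ofNat_ne_top
    (ENNReal.rpow_ne_top_of_nonneg (by norm_num) ENNReal.coe_ne_top))
    (ENNReal.mul_ne_top (ENNReal.mul_ne_top ENNReal.coe_ne_top (ENNReal.pow_ne_top hXitop)) (hMt _ (by norm_num)))
  have hS₂top : S₂ ≠ ∞ := ENNReal.mul_ne_top (ENNReal.mul_ne_top (ENNReal.mul_ne_top ENNReal.ofNat_ne_top
    (ENNReal.rpow_ne_top_of_nonneg (by norm_num) ENNReal.coe_ne_top)) (ENNReal.pow_ne_top hXitop))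
    (ENNReal.mul_ne_top (ENNReal.mul_ne_top ENNReal.coe_ne_top (ENNReal.pow_ne_top hXitop)) (hMt _ (by norm_num)))
  have hS₃top : S₃ ≠ ∞ := ENNReal.mul_ne_top (ENNReal.mul_ne_top (ENNReal.mul_ne_top ENNReal.ofNat_ne_top
    (ENNReal.rpow_ne_top_of_nonneg (by norm_num) ENNReal.coe_ne_top))
    (ENNReal.mul_ne_top (hXit _ (by norm_num)) (hMt _ (by norm_num))))
    (ENNReal.mul_ne_top (ENNReal.mul_ne_top (ENNReal.rpow_ne_top_of_nonneg (by norm_num) ENNReal.coe_ne_top)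
      (hXit _ (by norm_num))) (hMt _ (by norm_num)))
  have hS₄top : S₄ ≠ ∞ := ENNReal.mul_ne_top (ENNReal.mul_ne_top ENNReal.ofNat_ne_top hωtop)
    (ENNReal.mul_ne_top (ENNReal.mul_ne_top (ENNReal.mul_ne_top ENNReal.ofNat_ne_top
      (ENNReal.pow_ne_top ENNReal.coe_ne_top)) (ENNReal.pow_ne_top hYtop)) (ENNReal.pow_ne_top ENNReal.coe_ne_top))
  have hqi : q⁻¹ ≠ ∞ := ENNReal.inv_ne_top.2 hq0
  set K₁ : ℝ≥0∞ := (S₁ * q⁻¹ ^ (1 / 2 : ℝ)) ^ (1 / (1 - 1 / 2 : ℝ)) with hK₁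
  set K₂ : ℝ≥0∞ := (S₂ * q⁻¹ ^ (1 / 2 : ℝ)) ^ (1 / (1 - 1 / 2 : ℝ)) with hK₂
  set K₃ : ℝ≥0∞ := (S₃ * q⁻¹ ^ (3 / 4 : ℝ)) ^ (1 / (1 - 3 / 4 : ℝ)) with hK₃
  set K₄ : ℝ≥0∞ := (S₄ * q⁻¹ ^ (2 / 3 : ℝ)) ^ (1 / (1 - 2 / 3 : ℝ)) with hK₄
  have hKtop : ∀ {S : ℝ≥0∞} {e d : ℝ}, S ≠ ∞ → 0 ≤ e → 0 ≤ d → (S * q⁻¹ ^ e) ^ d ≠ ∞ := fun hS he hd =>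
    ENNReal.rpow_ne_top_of_nonneg hd (ENNReal.mul_ne_top hS (ENNReal.rpow_ne_top_of_nonneg he hqi))
  set b : ℝ≥0∞ := K₁ + K₂ + K₃ + K₄ with hb
  have hbtop : b ≠ ∞ := ENNReal.add_ne_top.2 ⟨ENNReal.add_ne_top.2 ⟨ENNReal.add_ne_top.2
    ⟨hKtop hS₁top (by norm_num) (by norm_num), hKtop hS₂top (by norm_num) (by norm_num)⟩,
    hKtop hS₃top (by norm_num) (by norm_num)⟩, hKtop hS₄top (by norm_num) (by norm_num)⟩
  -- ### finiteness of `A` below `r₀`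
  have hAfin : ∀ ϱ ∈ Ioc (0 : ℝ) r₀, cknAEss ϱ z u ≠ ∞ := fun ϱ hϱ =>
    ne_top_of_le_ne_top (ENNReal.mul_ne_top ENNReal.ofReal_ne_top hA₀)
      (cknAEss_le_mul_of_subset hr₀ hϱ.1 (Ioo_subset_Ioo (by nlinarith [hϱ.1, hϱ.2]) le_rfl)
        (ball_subset_ball hϱ.2) u)
  -- ### the one-step inequality for `Φ = A^{3/2} + ω D²`
  have step : ∀ ϱ, 0 < ϱ → ϱ ≤ r₀ →
      cknAEss (κ / 2 * ϱ) z u ^ (3 / 2 : ℝ) + ω * cknD (κ / 2 * ϱ) z p ^ 2 ≤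
        (cknAEss ϱ z u ^ (3 / 2 : ℝ) + ω * cknD ϱ z p ^ 2) / 2 + b := by
    intro ϱ hϱ0 hϱr₀
    have hϱ : ϱ ∈ Ioc (0 : ℝ) r₀ := ⟨hϱ0, hϱr₀⟩
    have hQϱ : parabolicCylinder ϱ z ⊆ (Q : Set (ℝ × EuclideanSpace ℝ (Fin 3))) :=
      (parabolicCylinder_mono hϱ0.le hϱr₀ z).trans hQ
    set a := cknAEss ϱ z u with hadef
    set d := cknD ϱ z p with hddef
    set 𝓐 := a ^ (3 / 2 : ℝ) with h𝓐
    have hatop : a ≠ ∞ := hAfin ϱ hϱ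
    have hEϱ : cknE ϱ z G ≤ M := hM ϱ hϱ
    have hEϱtop : cknE ϱ z G ≠ ∞ := ne_top_of_le_ne_top ENNReal.coe_ne_top hEϱ
    -- powers of `a` as powers of `𝓐`
    have ha34 : a ^ (3 / 4 : ℝ) = 𝓐 ^ (1 / 2 : ℝ) := by rw [h𝓐, ← ENNReal.rpow_mul]; norm_num
    have ha12 : a ^ (1 / 2 : ℝ) = 𝓐 ^ (1 / 3 : ℝ) := by rw [h𝓐, ← ENNReal.rpow_mul]; norm_num
    have ha1 : a = 𝓐 ^ (2 / 3 : ℝ) := by rw [h𝓐, ← ENNReal.rpow_mul]; norm_num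
    -- the small cylinder `R = κϱ`
    set R := κ * ϱ with hRdef
    have hR : 0 < R := mul_pos hκ0 hϱ0
    have hRϱ : R ≤ ϱ := by rw [hRdef]; nlinarith
    have hRr₀ : R ≤ r₀ := hRϱ.trans hϱr₀
    have hQR : parabolicCylinder R z ⊆ (Q : Set (ℝ × EuclideanSpace ℝ (Fin 3))) :=
      (parabolicCylinder_mono hR.le hRϱ z).trans hQϱ
    have hsubR : parabolicCylinder R z ⊆ parabolicCylinder ϱ z := parabolicCylinder_mono hR.le hRϱ z
    -- (1) the cubic quantity by the decay interpolation
    have hC : cknC R z u ≤ C₆ * (X ^ 3 * 𝓐) + C₆ * (Xi ^ 3 * (M : ℝ≥0∞) ^ (3 / 4 : ℝ)) * 𝓐 ^ (1 / 2 : ℝ) := by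
      have hGϱ : HasWeakSpatialGradientOn (parabolicCylinderOpens ϱ z) u G := hG.mono (fun w hw => hQϱ hw)
      have key := hC₆ u G z ϱ R hR hRϱ hGϱ hatop hEϱtop
      have e1 : R / ϱ = κ := by rw [hRdef]; field_simp
      have e2 : ϱ / R = κ⁻¹ := by rw [hRdef]; field_simp
      rw [e1, e2, hXieq] at key
      calc cknC R z u ≤ C₆ * (X ^ 3 * a ^ (3 / 2 : ℝ) + Xi ^ 3 * a ^ (3 / 4 : ℝ) * cknE ϱ z G ^ (3 / 4 : ℝ)) := key
        _ ≤ C₆ * (X ^ 3 * a ^ (3 / 2 : ℝ) + Xi ^ 3 * a ^ (3 / 4 : ℝ) * (M : ℝ≥0∞) ^ (3 / 4 : ℝ)) := by gcongr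
        _ = _ := by rw [ha34, h𝓐]; ring
    have hChalf : cknC R z u ^ (1 / 2 : ℝ) ≤ (C₆ : ℝ≥0∞) ^ (1 / 2 : ℝ) * X ^ (3 / 2 : ℝ) * 𝓐 ^ (1 / 2 : ℝ) +
        (C₆ : ℝ≥0∞) ^ (1 / 2 : ℝ) * Xi ^ (3 / 2 : ℝ) * (M : ℝ≥0∞) ^ (3 / 8 : ℝ) * 𝓐 ^ (1 / 4 : ℝ) := by
      refine (ENNReal.rpow_le_rpow hC (by norm_num)).trans ?_
      refine (ENNReal.rpow_add_le_add_rpow _ _ (by norm_num) (by norm_num)).trans (le_of_eq ?_)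
      have hX3 : (X ^ 3 : ℝ≥0∞) = X ^ (3 : ℝ) := by rw [← ENNReal.rpow_natCast]; norm_num
      have hXi3 : (Xi ^ 3 : ℝ≥0∞) = Xi ^ (3 : ℝ) := by rw [← ENNReal.rpow_natCast]; norm_num
      rw [hX3, hXi3]
      simp only [ENNReal.mul_rpow_of_nonneg _ _ (show (0 : ℝ) ≤ 1 / 2 by norm_num), ← ENNReal.rpow_mul]
      norm_num
      ring
    -- (2) energy and dissipation of the small cylinder
    have hAR : cknAEss R z u ≤ Xi * a := by
      have hI : Ioo (z.1 - R ^ 2) z.1 ⊆ Ioo (z.1 - ϱ ^ 2) z.1 :=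
        Ioo_subset_Ioo (by linarith [pow_le_pow_left₀ hR.le hRϱ 2]) le_rfl
      have := cknAEss_le_mul_of_subset (z := z) (z' := z) hϱ0 hR hI (ball_subset_ball hRϱ) u
      have e2 : ϱ / R = κ⁻¹ := by rw [hRdef]; field_simp
      rwa [e2, hXieq] at this
    have hER : cknE R z G ≤ M := hM R ⟨hR, hRr₀⟩
    have hAE : (cknAEss R z u * cknE R z G) ^ (3 / 4 : ℝ) ≤ Xi ^ (3 / 4 : ℝ) * (M : ℝ≥0∞) ^ (3 / 4 : ℝ) * 𝓐 ^ (1 / 2 : ℝ) := by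
      calc (cknAEss R z u * cknE R z G) ^ (3 / 4 : ℝ) ≤ (Xi * a * M) ^ (3 / 4 : ℝ) := by gcongr
        _ = _ := by
            rw [ENNReal.mul_rpow_of_nonneg _ _ (by norm_num : (0 : ℝ) ≤ 3 / 4),
              ENNReal.mul_rpow_of_nonneg Xi a (by norm_num : (0 : ℝ) ≤ 3 / 4), ha34]
            ring
    -- (3) the pressure of the small cylinder
    have hDR : cknD R z p ≤ κ₇ * Y * (M : ℝ≥0∞) * 𝓐 ^ (1 / 3 : ℝ) + κ₈ * X * d := by
      have key := HP Q u p G hsw hG z ϱ κ hϱ0 hκ0 hκhalf hQϱ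
      calc cknD R z p = cknD (κ * ϱ) z p := rfl
        _ ≤ κ₇ * Y * a ^ (1 / 2 : ℝ) * cknE ϱ z G + κ₈ * X * d := key
        _ ≤ κ₇ * Y * a ^ (1 / 2 : ℝ) * M + κ₈ * X * d := by gcongr
        _ = _ := by rw [ha12]; ring
    have hDsq : cknD R z p ^ 2 ≤ 2 * ((κ₇ : ℝ≥0∞) ^ 2 * Y ^ 2 * (M : ℝ≥0∞) ^ 2) * 𝓐 ^ (2 / 3 : ℝ) +
        2 * ((κ₈ : ℝ≥0∞) ^ 2 * X ^ 2) * d ^ 2 := by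
      refine (pow_le_pow_left' hDR 2).trans ((PoincareBall.add_sq_le_two_mul_sq_add _ _).trans (le_of_eq ?_))
      rw [mul_pow, mul_pow, mul_pow, mul_pow, mul_pow, ← ENNReal.rpow_natCast (𝓐 ^ (1 / 3 : ℝ)) 2,
        ← ENNReal.rpow_mul]
      norm_num
      ring
    -- (4) the energy at `R/2` by the product-form local energy estimate
    have hT8 : cknAEss (R / 2) z u ≤ k₁ * cknC R z u ^ (2 / 3 : ℝ) +
        k₂ * ((cknAEss R z u * cknE R z G) ^ (1 / 2 : ℝ) * cknC R z u ^ (1 / 3 : ℝ)) +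
        k₃ * (cknD R z p ^ (2 / 3 : ℝ) * cknC R z u ^ (1 / 3 : ℝ)) :=
      le_self_add.trans (HT Q u p G hsw hG z R hR hQR)
    -- (5) the pressure at `R/2` by monotonicity
    have hDhalf : cknD (R / 2) z p ≤ 4 * cknD R z p := by
      have := cknD_le_mul_of_subset hR (half_pos hR) (parabolicCylinder_mono (half_pos hR).le (by linarith) z) p
      have e4 : ENNReal.ofReal (R / (R / 2)) ^ 2 = 4 := by
        rw [show R / (R / 2) = 2 by field_simp, ENNReal.ofReal_ofNat]; norm_num
      rwa [e4] at this
    -- ### assembling the step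
    have hγ : κ / 2 * ϱ = R / 2 := by rw [hRdef]; ring
    rw [hγ]
    set C := cknC R z u with hCdef
    set AR := cknAEss R z u with hARdef
    set ER := cknE R z G with hERdef
    set DR := cknD R z p with hDRdef
    -- stage 1
    have hA32 : cknAEss (R / 2) z u ^ (3 / 2 : ℝ) ≤ 4 * ((k₁ : ℝ≥0∞) ^ (3 / 2 : ℝ) * C +
        (k₂ : ℝ≥0∞) ^ (3 / 2 : ℝ) * ((AR * ER) ^ (3 / 4 : ℝ) * C ^ (1 / 2 : ℝ)) +
        (k₃ : ℝ≥0∞) ^ (3 / 2 : ℝ) * (DR * C ^ (1 / 2 : ℝ))) := by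
      refine (ENNReal.rpow_le_rpow hT8 (by norm_num)).trans ((RRS2016.ennreal_add_three_rpow_threeHalves_le _ _ _).trans (le_of_eq ?_))
      congr 1
      simp only [ENNReal.mul_rpow_of_nonneg _ _ (show (0 : ℝ) ≤ 3 / 2 by norm_num), ← ENNReal.rpow_mul]
      norm_num
    have hD2 : ω * cknD (R / 2) z p ^ 2 ≤ 16 * ω * DR ^ 2 := by
      calc ω * cknD (R / 2) z p ^ 2 ≤ ω * (4 * DR) ^ 2 := by gcongr
        _ = 16 * ω * DR ^ 2 := by ring
    -- stage 2: Young on the mixed pressure term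
    have hYoung : 4 * ((k₃ : ℝ≥0∞) ^ (3 / 2 : ℝ) * (DR * C ^ (1 / 2 : ℝ))) ≤ ω * DR ^ 2 +
        4 * (k₃ : ℝ≥0∞) ^ (3 / 2 : ℝ) * Xi ^ 2 * C := by
      calc 4 * ((k₃ : ℝ≥0∞) ^ (3 / 2 : ℝ) * (DR * C ^ (1 / 2 : ℝ)))
          ≤ 4 * ((k₃ : ℝ≥0∞) ^ (3 / 2 : ℝ) * (X ^ 2 * DR ^ 2 + X⁻¹ ^ 2 * C)) := by
            gcongr; exact mul_rpow_half_le_weighted DR C hX0 hXtop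
        _ = (4 * (k₃ : ℝ≥0∞) ^ (3 / 2 : ℝ) * X ^ 2) * DR ^ 2 + 4 * (k₃ : ℝ≥0∞) ^ (3 / 2 : ℝ) * Xi ^ 2 * C := by
            rw [hXi]; ring
        _ ≤ ω * DR ^ 2 + 4 * (k₃ : ℝ≥0∞) ^ (3 / 2 : ℝ) * Xi ^ 2 * C := by gcongr
    have stage2 : cknAEss (R / 2) z u ^ (3 / 2 : ℝ) + ω * cknD (R / 2) z p ^ 2 ≤
        (4 * (k₁ : ℝ≥0∞) ^ (3 / 2 : ℝ) + 4 * (k₃ : ℝ≥0∞) ^ (3 / 2 : ℝ) * Xi ^ 2) * C +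
        4 * (k₂ : ℝ≥0∞) ^ (3 / 2 : ℝ) * ((AR * ER) ^ (3 / 4 : ℝ) * C ^ (1 / 2 : ℝ)) + 17 * ω * DR ^ 2 := by
      calc cknAEss (R / 2) z u ^ (3 / 2 : ℝ) + ω * cknD (R / 2) z p ^ 2
          ≤ 4 * ((k₁ : ℝ≥0∞) ^ (3 / 2 : ℝ) * C + (k₂ : ℝ≥0∞) ^ (3 / 2 : ℝ) * ((AR * ER) ^ (3 / 4 : ℝ) * C ^ (1 / 2 : ℝ)) +
              (k₃ : ℝ≥0∞) ^ (3 / 2 : ℝ) * (DR * C ^ (1 / 2 : ℝ))) + 16 * ω * DR ^ 2 := add_le_add hA32 hD2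
        _ = 4 * (k₁ : ℝ≥0∞) ^ (3 / 2 : ℝ) * C + 4 * (k₂ : ℝ≥0∞) ^ (3 / 2 : ℝ) * ((AR * ER) ^ (3 / 4 : ℝ) * C ^ (1 / 2 : ℝ)) +
            4 * ((k₃ : ℝ≥0∞) ^ (3 / 2 : ℝ) * (DR * C ^ (1 / 2 : ℝ))) + 16 * ω * DR ^ 2 := by ring
        _ ≤ 4 * (k₁ : ℝ≥0∞) ^ (3 / 2 : ℝ) * C + 4 * (k₂ : ℝ≥0∞) ^ (3 / 2 : ℝ) * ((AR * ER) ^ (3 / 4 : ℝ) * C ^ (1 / 2 : ℝ)) +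
            (ω * DR ^ 2 + 4 * (k₃ : ℝ≥0∞) ^ (3 / 2 : ℝ) * Xi ^ 2 * C) + 16 * ω * DR ^ 2 := by gcongr
        _ = _ := by ring
    -- stage 3: substitute the bounds (1)–(3)
    have hlinI : (4 * (k₁ : ℝ≥0∞) ^ (3 / 2 : ℝ)) * (C₆ * (X ^ 3 * 𝓐)) ≤ q * 𝓐 := by
      calc (4 * (k₁ : ℝ≥0∞) ^ (3 / 2 : ℝ)) * (C₆ * (X ^ 3 * 𝓐)) = (4 * (k₁ : ℝ≥0∞) ^ (3 / 2 : ℝ) * C₆ * X ^ 3) * 𝓐 := by ring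
        _ ≤ q * 𝓐 := mul_le_mul_left Hb' _
    have hlinIII : (4 * (k₃ : ℝ≥0∞) ^ (3 / 2 : ℝ) * Xi ^ 2) * (C₆ * (X ^ 3 * 𝓐)) ≤ q * 𝓐 := by
      calc (4 * (k₃ : ℝ≥0∞) ^ (3 / 2 : ℝ) * Xi ^ 2) * (C₆ * (X ^ 3 * 𝓐))
          = (4 * (k₃ : ℝ≥0∞) ^ (3 / 2 : ℝ) * C₆ * (Xi ^ 2 * X ^ 3)) * 𝓐 := by ring
        _ = (4 * (k₃ : ℝ≥0∞) ^ (3 / 2 : ℝ) * C₆ * X) * 𝓐 := by rw [hXi, inv_sq_mul_cube hX0 hXtop]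
        _ ≤ q * 𝓐 := mul_le_mul_left Hc' _
    have hlinII : 4 * (k₂ : ℝ≥0∞) ^ (3 / 2 : ℝ) * (Xi ^ (3 / 4 : ℝ) * (M : ℝ≥0∞) ^ (3 / 4 : ℝ) * 𝓐 ^ (1 / 2 : ℝ)) *
        ((C₆ : ℝ≥0∞) ^ (1 / 2 : ℝ) * X ^ (3 / 2 : ℝ) * 𝓐 ^ (1 / 2 : ℝ)) ≤ 2 * q * 𝓐 := by
      calc 4 * (k₂ : ℝ≥0∞) ^ (3 / 2 : ℝ) * (Xi ^ (3 / 4 : ℝ) * (M : ℝ≥0∞) ^ (3 / 4 : ℝ) * 𝓐 ^ (1 / 2 : ℝ)) *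
            ((C₆ : ℝ≥0∞) ^ (1 / 2 : ℝ) * X ^ (3 / 2 : ℝ) * 𝓐 ^ (1 / 2 : ℝ))
          = (4 * (k₂ : ℝ≥0∞) ^ (3 / 2 : ℝ) * (C₆ : ℝ≥0∞) ^ (1 / 2 : ℝ) * (M : ℝ≥0∞) ^ (3 / 4 : ℝ) *
              (Xi ^ (3 / 4 : ℝ) * X ^ (3 / 2 : ℝ))) * (𝓐 ^ (1 / 2 : ℝ) * 𝓐 ^ (1 / 2 : ℝ)) := by ring
        _ = (4 * (k₂ : ℝ≥0∞) ^ (3 / 2 : ℝ) * (C₆ : ℝ≥0∞) ^ (1 / 2 : ℝ) * (M : ℝ≥0∞) ^ (3 / 4 : ℝ) * X ^ (3 / 4 : ℝ)) * 𝓐 := by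
            rw [hXi, inv_rpow_mul_rpow_threeHalves hX0 hXtop, ← ENNReal.rpow_add_of_nonneg _ _ (by norm_num) (by norm_num)]
            norm_num
        _ ≤ 2 * q * 𝓐 := mul_le_mul_left Hd' _
    have hsubII : 4 * (k₂ : ℝ≥0∞) ^ (3 / 2 : ℝ) * (Xi ^ (3 / 4 : ℝ) * (M : ℝ≥0∞) ^ (3 / 4 : ℝ) * 𝓐 ^ (1 / 2 : ℝ)) *
        ((C₆ : ℝ≥0∞) ^ (1 / 2 : ℝ) * Xi ^ (3 / 2 : ℝ) * (M : ℝ≥0∞) ^ (3 / 8 : ℝ) * 𝓐 ^ (1 / 4 : ℝ)) = S₃ * 𝓐 ^ (3 / 4 : ℝ) := by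
      rw [hS₃]
      calc _ = 4 * (k₂ : ℝ≥0∞) ^ (3 / 2 : ℝ) * (Xi ^ (3 / 4 : ℝ) * (M : ℝ≥0∞) ^ (3 / 4 : ℝ)) *
            ((C₆ : ℝ≥0∞) ^ (1 / 2 : ℝ) * Xi ^ (3 / 2 : ℝ) * (M : ℝ≥0∞) ^ (3 / 8 : ℝ)) * (𝓐 ^ (1 / 2 : ℝ) * 𝓐 ^ (1 / 4 : ℝ)) := by ring
        _ = _ := by rw [← ENNReal.rpow_add_of_nonneg _ _ (by norm_num) (by norm_num)]; norm_num
    have hdcoef : 17 * ω * (2 * ((κ₈ : ℝ≥0∞) ^ 2 * X ^ 2) * d ^ 2) ≤ 2⁻¹ * (ω * d ^ 2) := by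
      calc 17 * ω * (2 * ((κ₈ : ℝ≥0∞) ^ 2 * X ^ 2) * d ^ 2) = (34 * (κ₈ : ℝ≥0∞) ^ 2 * X ^ 2) * (ω * d ^ 2) := by ring
        _ ≤ 2⁻¹ * (ω * d ^ 2) := mul_le_mul_left Ha' _
    -- absorption of the four sublinear terms
    have hab1 : S₁ * 𝓐 ^ (1 / 2 : ℝ) ≤ q * 𝓐 + K₁ := rpow_le_mul_add (by norm_num) (by norm_num) S₁ 𝓐 hq0 hqtop
    have hab2 : S₂ * 𝓐 ^ (1 / 2 : ℝ) ≤ q * 𝓐 + K₂ := rpow_le_mul_add (by norm_num) (by norm_num) S₂ 𝓐 hq0 hqtop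
    have hab3 : S₃ * 𝓐 ^ (3 / 4 : ℝ) ≤ q * 𝓐 + K₃ := rpow_le_mul_add (by norm_num) (by norm_num) S₃ 𝓐 hq0 hqtop
    have hab4 : S₄ * 𝓐 ^ (2 / 3 : ℝ) ≤ q * 𝓐 + K₄ := rpow_le_mul_add (by norm_num) (by norm_num) S₄ 𝓐 hq0 hqtop
    calc cknAEss (R / 2) z u ^ (3 / 2 : ℝ) + ω * cknD (R / 2) z p ^ 2
        ≤ (4 * (k₁ : ℝ≥0∞) ^ (3 / 2 : ℝ) + 4 * (k₃ : ℝ≥0∞) ^ (3 / 2 : ℝ) * Xi ^ 2) * C +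
          4 * (k₂ : ℝ≥0∞) ^ (3 / 2 : ℝ) * ((AR * ER) ^ (3 / 4 : ℝ) * C ^ (1 / 2 : ℝ)) + 17 * ω * DR ^ 2 := stage2
      _ ≤ (4 * (k₁ : ℝ≥0∞) ^ (3 / 2 : ℝ) + 4 * (k₃ : ℝ≥0∞) ^ (3 / 2 : ℝ) * Xi ^ 2) *
            (C₆ * (X ^ 3 * 𝓐) + C₆ * (Xi ^ 3 * (M : ℝ≥0∞) ^ (3 / 4 : ℝ)) * 𝓐 ^ (1 / 2 : ℝ)) +
          4 * (k₂ : ℝ≥0∞) ^ (3 / 2 : ℝ) * ((Xi ^ (3 / 4 : ℝ) * (M : ℝ≥0∞) ^ (3 / 4 : ℝ) * 𝓐 ^ (1 / 2 : ℝ)) *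
            ((C₆ : ℝ≥0∞) ^ (1 / 2 : ℝ) * X ^ (3 / 2 : ℝ) * 𝓐 ^ (1 / 2 : ℝ) +
              (C₆ : ℝ≥0∞) ^ (1 / 2 : ℝ) * Xi ^ (3 / 2 : ℝ) * (M : ℝ≥0∞) ^ (3 / 8 : ℝ) * 𝓐 ^ (1 / 4 : ℝ))) +
          17 * ω * (2 * ((κ₇ : ℝ≥0∞) ^ 2 * Y ^ 2 * (M : ℝ≥0∞) ^ 2) * 𝓐 ^ (2 / 3 : ℝ) +
            2 * ((κ₈ : ℝ≥0∞) ^ 2 * X ^ 2) * d ^ 2) := by gcongr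
      _ = (4 * (k₁ : ℝ≥0∞) ^ (3 / 2 : ℝ)) * (C₆ * (X ^ 3 * 𝓐)) +
          (4 * (k₃ : ℝ≥0∞) ^ (3 / 2 : ℝ) * Xi ^ 2) * (C₆ * (X ^ 3 * 𝓐)) +
          S₁ * 𝓐 ^ (1 / 2 : ℝ) + S₂ * 𝓐 ^ (1 / 2 : ℝ) +
          4 * (k₂ : ℝ≥0∞) ^ (3 / 2 : ℝ) * (Xi ^ (3 / 4 : ℝ) * (M : ℝ≥0∞) ^ (3 / 4 : ℝ) * 𝓐 ^ (1 / 2 : ℝ)) *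
            ((C₆ : ℝ≥0∞) ^ (1 / 2 : ℝ) * X ^ (3 / 2 : ℝ) * 𝓐 ^ (1 / 2 : ℝ)) +
          4 * (k₂ : ℝ≥0∞) ^ (3 / 2 : ℝ) * (Xi ^ (3 / 4 : ℝ) * (M : ℝ≥0∞) ^ (3 / 4 : ℝ) * 𝓐 ^ (1 / 2 : ℝ)) *
            ((C₆ : ℝ≥0∞) ^ (1 / 2 : ℝ) * Xi ^ (3 / 2 : ℝ) * (M : ℝ≥0∞) ^ (3 / 8 : ℝ) * 𝓐 ^ (1 / 4 : ℝ)) +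
          S₄ * 𝓐 ^ (2 / 3 : ℝ) + 17 * ω * (2 * ((κ₈ : ℝ≥0∞) ^ 2 * X ^ 2) * d ^ 2) := by
          rw [hS₁, hS₂, hS₄]; ring
      _ ≤ q * 𝓐 + q * 𝓐 + (q * 𝓐 + K₁) + (q * 𝓐 + K₂) + 2 * q * 𝓐 + (q * 𝓐 + K₃) + (q * 𝓐 + K₄) +
          2⁻¹ * (ω * d ^ 2) := by
          rw [hsubII]
          exact add_le_add (add_le_add (add_le_add (add_le_add (add_le_add (add_le_add (add_le_add hlinI hlinIII)
            hab1) hab2) hlinII) hab3) hab4) hdcoef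
      _ = (8 * q) * 𝓐 + 2⁻¹ * (ω * d ^ 2) + b := by rw [hb]; ring
      _ = (𝓐 + ω * d ^ 2) / 2 + b := by rw [h8q, div_eq_mul_inv]; ring
  -- ### the iteration and the bound on `A` along `γᵏ r₀`, `γ = κ/2`
  have hγ0 : 0 < κ / 2 := half_pos hκ0
  have hγ1 : κ / 2 ≤ 1 := by linarith
  have hE₀ : cknE r₀ z G ≠ ∞ := ne_top_of_le_ne_top ENNReal.coe_ne_top (hM r₀ ⟨hr₀, le_rfl⟩)
  set Φ₀ : ℝ≥0∞ := 2 * b + (cknAEss r₀ z u ^ (3 / 2 : ℝ) + ω * cknD r₀ z p ^ 2) with hΦ₀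
  have hΦ₀top : Φ₀ ≠ ∞ := ENNReal.add_ne_top.2 ⟨ENNReal.mul_ne_top ENNReal.ofNat_ne_top hbtop,
    ENNReal.add_ne_top.2 ⟨ENNReal.rpow_ne_top_of_nonneg (by norm_num) hA₀,
      ENNReal.mul_ne_top hωtop (ENNReal.pow_ne_top hD₀)⟩⟩
  have hiter : ∀ k : ℕ, cknAEss ((κ / 2) ^ k * r₀) z u ^ (3 / 2 : ℝ) ≤ Φ₀ := by
    intro k
    have := iterate_half_le (φ := fun ρ => cknAEss ρ z u ^ (3 / 2 : ℝ) + ω * cknD ρ z p ^ 2) hγ0 hγ1 hr₀ step k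
    refine le_self_add.trans (this.trans ?_)
    rw [hΦ₀]
    gcongr
    calc (2⁻¹ : ℝ≥0∞) ^ k * (cknAEss r₀ z u ^ (3 / 2 : ℝ) + ω * cknD r₀ z p ^ 2)
        ≤ 1 * (cknAEss r₀ z u ^ (3 / 2 : ℝ) + ω * cknD r₀ z p ^ 2) := by
          gcongr
          exact pow_le_one₀ zero_le (ENNReal.inv_le_one.2 one_le_two)
      _ = _ := one_mul _
  -- ### `A` at every radius `0 < r ≤ r₀`
  have hAr : ∀ r ∈ Ioc (0 : ℝ) r₀, cknAEss r z u ≤ ENNReal.ofReal ((κ / 2)⁻¹) * Φ₀ ^ (2 / 3 : ℝ) := by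
    intro r hr
    obtain ⟨J, hJ1, hJ2⟩ := exists_nat_pow_near_of_lt_one (div_pos hr.1 hr₀)
      ((div_le_one hr₀).2 hr.2) hγ0 (by linarith)
    have hle : r ≤ (κ / 2) ^ J * r₀ := by rwa [div_le_iff₀ hr₀] at hJ2
    have hpos : 0 < (κ / 2) ^ J * r₀ := by positivity
    have hlt : (κ / 2) ^ J * r₀ < (κ / 2)⁻¹ * r := by
      rw [lt_div_iff₀ hr₀] at hJ1
      have : (κ / 2) ^ J * r₀ = (κ / 2)⁻¹ * ((κ / 2) ^ (J + 1) * r₀) := by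
        rw [pow_succ]; field_simp
      rw [this]
      exact mul_lt_mul_of_pos_left hJ1 (inv_pos.2 hγ0)
    have hI : Ioo (z.1 - r ^ 2) z.1 ⊆ Ioo (z.1 - ((κ / 2) ^ J * r₀) ^ 2) z.1 :=
      Ioo_subset_Ioo (by linarith [pow_le_pow_left₀ hr.1.le hle 2]) le_rfl
    have hA32 : cknAEss ((κ / 2) ^ J * r₀) z u ≤ Φ₀ ^ (2 / 3 : ℝ) := by
      have := ENNReal.rpow_le_rpow (hiter J) (by norm_num : (0 : ℝ) ≤ 2 / 3)
      rwa [← ENNReal.rpow_mul, show (3 / 2 : ℝ) * (2 / 3) = 1 by norm_num, ENNReal.rpow_one] at this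
    calc cknAEss r z u ≤ ENNReal.ofReal ((κ / 2) ^ J * r₀ / r) * cknAEss ((κ / 2) ^ J * r₀) z u :=
          cknAEss_le_mul_of_subset (z := z) (z' := z) hpos hr.1 hI (ball_subset_ball hle) u
      _ ≤ ENNReal.ofReal ((κ / 2)⁻¹) * Φ₀ ^ (2 / 3 : ℝ) := by
          gcongr
          exact (div_le_iff₀ hr.1).2 hlt.le
  -- ### the case `A`
  set Abar : ℝ≥0∞ := ENNReal.ofReal ((κ / 2)⁻¹) * Φ₀ ^ (2 / 3 : ℝ) with hAbar
  have hAbartop : Abar ≠ ∞ := ENNReal.mul_ne_top ENNReal.ofReal_ne_top (ENNReal.rpow_ne_top_of_nonneg (by norm_num) hΦ₀top)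
  have hAb : ∀ r ∈ Ioc (0 : ℝ) r₀, cknAEss r z u ≤ (Abar.toNNReal : ℝ≥0∞) := fun r hr => by
    rw [ENNReal.coe_toNNReal hAbartop]; exact hAr r hr
  exact scaledEnergies_bounded_of_cknAEss_le hsw hG hr₀ hQ hE₀ hD₀ hAb

/-- **The case `limsup_{r→0} E(z, r) < ∞` of "`g < ∞ ⇒ G < ∞`"** (Seregin 2020, remark after
Def. 1.7, after Seregin 2006; the case of the Caffarelli–Kohn–Nirenberg quantity): for a suitable
weak solution on `Q ⊇ Q_{r₀}(z)` with `A(r₀; z), D(r₀; z) < ∞`, a finite upper limit of the scaled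
dissipation at `z` bounds `A, E, C, D` at `z` on some `]0, r₁]`. [cite: Seregin2020, remark after Def. 1.7 and (2.7)] -/
theorem scaledEnergies_bounded_of_limsup_cknE_lt_top {Q : Opens (ℝ × EuclideanSpace ℝ (Fin 3))}
    {u : ℝ → EuclideanSpace ℝ (Fin 3) → EuclideanSpace ℝ (Fin 3)}
    {p : ℝ → EuclideanSpace ℝ (Fin 3) → ℝ}
    {G : ℝ → EuclideanSpace ℝ (Fin 3) → EuclideanSpace ℝ (Fin 3) →L[ℝ] EuclideanSpace ℝ (Fin 3)}
    (hsw : IsSuitableWeakSolutionOn Q 1 0 u p) (hG : HasWeakSpatialGradientOn Q u G)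
    {z : ℝ × EuclideanSpace ℝ (Fin 3)} {r₀ : ℝ} (hr₀ : 0 < r₀)
    (hQ : parabolicCylinder r₀ z ⊆ (Q : Set (ℝ × EuclideanSpace ℝ (Fin 3))))
    (hA₀ : cknAEss r₀ z u ≠ ∞) (hD₀ : cknD r₀ z p ≠ ∞)
    (hE : limsup (fun r => cknE r z G) (𝓝[>] 0) < ∞) :
    ∃ K : ℝ≥0, ∃ r₁ : ℝ, 0 < r₁ ∧ ∀ r ∈ Ioc (0 : ℝ) r₁,
      cknAEss r z u + cknE r z G + cknC r z u + cknD r z p ≤ K := by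
  obtain ⟨M, ρ, hρ, hM⟩ := exists_bound_of_limsup_lt_top hE
  set r₂ := min ρ r₀ with hr₂
  have hr₂0 : 0 < r₂ := lt_min hρ hr₀
  have hr₂ρ : r₂ ≤ ρ := min_le_left _ _
  have hr₂r₀ : r₂ ≤ r₀ := min_le_right _ _
  have hsub : parabolicCylinder r₂ z ⊆ parabolicCylinder r₀ z := parabolicCylinder_mono hr₂0.le hr₂r₀ z
  have hQ₂ : parabolicCylinder r₂ z ⊆ (Q : Set (ℝ × EuclideanSpace ℝ (Fin 3))) := hsub.trans hQ
  have hD₂ : cknD r₂ z p ≠ ∞ :=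
    ne_top_of_le_ne_top (ENNReal.mul_ne_top (ENNReal.pow_ne_top ENNReal.ofReal_ne_top) hD₀)
      (cknD_le_mul_of_subset hr₀ hr₂0 hsub p)
  have hA₂ : cknAEss r₂ z u ≠ ∞ :=
    ne_top_of_le_ne_top (ENNReal.mul_ne_top ENNReal.ofReal_ne_top hA₀)
      (cknAEss_le_mul_of_subset (z := z) (z' := z) hr₀ hr₂0
        (Ioo_subset_Ioo (by nlinarith [pow_le_pow_left₀ hr₂0.le hr₂r₀ 2]) le_rfl) (ball_subset_ball hr₂r₀) u)
  have hM₂ : ∀ r ∈ Ioc (0 : ℝ) r₂, cknE r z G ≤ M := fun r hr => hM r ⟨hr.1, hr.2.trans hr₂ρ⟩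
  obtain ⟨K, hK⟩ := scaledEnergies_bounded_of_cknE_le hsw hG hr₂0 hQ₂ hA₂ hD₂ hM₂
  exact ⟨K, r₂ / 2, half_pos hr₂0, hK⟩

/-- **Seregin 2020, the remark after Def. 1.7: `g(z₀) < ∞ ⇒ G(z₀) < ∞`** (after Seregin 2006,
"`D₀` can be replaced with `D`", Seregin–Zajaczkowski 2007, Lemma 2.1), in the accepted
vocabulary and with the plain pressure quantity `D`: let `(u, p)` be a suitable weak solution of
the unforced Navier–Stokes equations (`ν = 1`) on an open `Q`, `G` a weak spatial gradient of `u`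
on `Q`, and `Q_{r₀}(z) ⊆ Q` a backward cylinder (possibly touching the top of `Q`) on which
`A, E, D` are finite. If the blow-up index
`g(z) = min{limsup E, limsup A, limsup C}` (`blowupIndex`) is finite, then all four
scaled quantities `A, E, C, D` are bounded on some interval of radii `]0, r₁]` — the bound (2.7),
`L₀ = sup A + sup C + sup E + sup D < ∞`, from which the proof of Theorem 2.1 proceeds.
[cite: Seregin2020, remark after Def. 1.7 and (2.7)] -/
theorem scaledEnergies_bounded_of_blowupIndex_lt_top {Q : Opens (ℝ × EuclideanSpace ℝ (Fin 3))}
    {u : ℝ → EuclideanSpace ℝ (Fin 3) → EuclideanSpace ℝ (Fin 3)}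
    {p : ℝ → EuclideanSpace ℝ (Fin 3) → ℝ}
    {G : ℝ → EuclideanSpace ℝ (Fin 3) → EuclideanSpace ℝ (Fin 3) →L[ℝ] EuclideanSpace ℝ (Fin 3)}
    (hsw : IsSuitableWeakSolutionOn Q 1 0 u p) (hG : HasWeakSpatialGradientOn Q u G)
    {z : ℝ × EuclideanSpace ℝ (Fin 3)} {r₀ : ℝ} (hr₀ : 0 < r₀)
    (hQ : parabolicCylinder r₀ z ⊆ (Q : Set (ℝ × EuclideanSpace ℝ (Fin 3))))
    (hA₀ : cknAEss r₀ z u ≠ ∞) (hE₀ : cknE r₀ z G ≠ ∞) (hD₀ : cknD r₀ z p ≠ ∞)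
    (hI : blowupIndex z u G < ∞) :
    ∃ K : ℝ≥0, ∃ r₁ : ℝ, 0 < r₁ ∧ ∀ r ∈ Ioc (0 : ℝ) r₁,
      cknAEss r z u + cknE r z G + cknC r z u + cknD r z p ≤ K := by
  rcases blowupIndex_lt_top_iff.1 hI with hE | hA | hC
  · exact scaledEnergies_bounded_of_limsup_cknE_lt_top hsw hG hr₀ hQ hA₀ hD₀ hE
  · exact scaledEnergies_bounded_of_limsup_cknA_lt_top hsw hG hr₀ hQ hE₀ hD₀ hA
  · exact scaledEnergies_bounded_of_limsup_cknC_lt_top hsw hG hr₀ hQ hD₀ hC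

/-- **(2.7) under the hypotheses of Theorem 2.1** (Seregin 2020, proof of Thm. 2.1: "So, without
lose of generality, we may assume that `0 < L₀ = sup_{0<r<1} A(r) + sup C(r) + sup E(r) + sup D(r)
< ∞`"): for a suitable weak solution in Seregin's unit cylinder `Q = 𝒞 × ]-1, 0[` in the sense
of Def. 1.3 (the accepted local notion plus the global classes `u ∈ L_{2,∞}(Q)`,
`∇u = G ∈ L₂(Q)`, `p ∈ L_{3/2}(Q)`, exactly the hypotheses of the named fact
`Seregin2020_axisymmetricSingularPoint_typeII`), a Type I index `g(0) < ∞` at the origin makes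
all of `A, E, C, D` bounded on the backward parabolic balls `Q(0, r)`, `0 < r ≤ r₁`.
[cite: Seregin2020, proof of Thm. 2.1, (2.5)–(2.7)] -/
theorem typeI_scaledEnergies_bounded
    {u : ℝ → EuclideanSpace ℝ (Fin 3) → EuclideanSpace ℝ (Fin 3)}
    {p : ℝ → EuclideanSpace ℝ (Fin 3) → ℝ}
    {G : ℝ → EuclideanSpace ℝ (Fin 3) → EuclideanSpace ℝ (Fin 3) →L[ℝ] EuclideanSpace ℝ (Fin 3)}
    (hsw : IsSuitableWeakSolutionOn (SereginSverak2009.parCylOpens 0 1) 1 0 u p)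
    (hA : ∃ C : ℝ≥0, ∀ᵐ t ∂(volume.restrict (Ioo (-1 : ℝ) 0)),
      ∫⁻ x in SereginSverak2009.spaceCyl 0 1, ‖u t x‖ₑ ^ 2 ≤ C)
    (hG : HasWeakSpatialGradientOn (SereginSverak2009.parCylOpens 0 1) u G)
    (hE : ∫⁻ z in SereginSverak2009.parCyl 0 1, ENNReal.ofReal (frobeniusNormSq (G z.1 z.2)) < ∞)
    (hp : ∫⁻ z in SereginSverak2009.parCyl 0 1, ‖p z.1 z.2‖ₑ ^ (3 / 2 : ℝ) < ∞)
    (hI : blowupIndex 0 u G < ∞) :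
    ∃ K : ℝ≥0, ∃ r₁ : ℝ, 0 < r₁ ∧ ∀ r ∈ Ioc (0 : ℝ) r₁,
      cknAEss r (0 : ℝ × EuclideanSpace ℝ (Fin 3)) u + cknE r (0 : ℝ × EuclideanSpace ℝ (Fin 3)) G +
        cknC r (0 : ℝ × EuclideanSpace ℝ (Fin 3)) u + cknD r (0 : ℝ × EuclideanSpace ℝ (Fin 3)) p ≤ K := by
  have hQ : parabolicCylinder 1 (0 : ℝ × EuclideanSpace ℝ (Fin 3)) ⊆
      ((SereginSverak2009.parCylOpens 0 1 : Opens (ℝ × EuclideanSpace ℝ (Fin 3))) :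
        Set (ℝ × EuclideanSpace ℝ (Fin 3))) := by
    rw [SereginSverak2009.coe_parCylOpens]
    exact parabolicCylinder_subset_parCyl 0 1
  have hsub := parabolicCylinder_subset_parCyl (0 : ℝ × EuclideanSpace ℝ (Fin 3)) 1
  -- finiteness of `A(1), E(1), D(1)` from the global classes
  have hA₀ : cknAEss 1 (0 : ℝ × EuclideanSpace ℝ (Fin 3)) u ≠ ∞ := by
    obtain ⟨C, hC⟩ := hA
    have hQI : Ioo ((0 : ℝ × EuclideanSpace ℝ (Fin 3)).1 - 1 ^ 2) (0 : ℝ × EuclideanSpace ℝ (Fin 3)).1 =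
        Ioo (-1 : ℝ) 0 := by simp
    have hbound : ∀ᵐ t ∂(volume.restrict (Ioo (-1 : ℝ) 0)),
        (ENNReal.ofReal (1 : ℝ))⁻¹ * ∫⁻ x in ball (0 : ℝ × EuclideanSpace ℝ (Fin 3)).2 1, ‖u t x‖ₑ ^ 2 ≤ C := by
      filter_upwards [hC] with t ht
      rw [ENNReal.ofReal_one, inv_one, one_mul, Prod.snd_zero]
      exact (lintegral_mono_set (ball_subset_spaceCyl 0 1)).trans ht
    have : cknAEss 1 (0 : ℝ × EuclideanSpace ℝ (Fin 3)) u ≤ C := by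
      simp only [cknAEss, hQI]
      exact essSup_le_of_ae_le _ hbound
    exact ne_top_of_le_ne_top ENNReal.coe_ne_top this
  have hE₀ : cknE 1 (0 : ℝ × EuclideanSpace ℝ (Fin 3)) G ≠ ∞ := by
    rw [cknE, ENNReal.ofReal_one, inv_one, one_mul]
    exact (lt_of_le_of_lt (lintegral_mono_set hsub) hE).ne
  have hD₀ : cknD 1 (0 : ℝ × EuclideanSpace ℝ (Fin 3)) p ≠ ∞ := by
    rw [cknD, ENNReal.ofReal_one, one_pow, inv_one, one_mul]
    exact (lt_of_le_of_lt (lintegral_mono_set hsub) hp).ne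
  exact scaledEnergies_bounded_of_blowupIndex_lt_top hsw hG one_pos hQ hA₀ hE₀ hD₀ hI


end Seregin2020

end Literature.Analysis.FluidPDE
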